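import Summits.Parity.BatemanHorn.Theorems.AlmostPrimeZerosSystemLSDRealSegmentCongruenceFacts
import Summits.Parity.BatemanHorn.Theorems.AlmostPrimeZerosSystemLSDRealSegmentLevinFainleib
import Summits.Parity.BatemanHorn.Theorems.AlmostPrimeZerosSystemLSDRealSegmentSandwich
import Summits.Parity.BatemanHorn.Theorems.AlmostPrimeZerosSystemLSDRealSegmentLocal
import Summits.Parity.BatemanHorn.Theorems.AlmostPrimeZerosSystemLSDRealSegmentLimit
import HarnessLib

/-!
# `SystemLSDRealSegment` (stmt-Parity-11292), line `beta-thinned-root-kernel`: reduction to the kernel law (core)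

Sorry-free composition of the line's LANDED stubs (lead prover, 2026-08-16), the part that does not need the module
`…EulerFactor` (holomorphy / value at `0` of `λ_f`):

* `typeILaw_holds` (registered name) — the LEVEL-`x` HALF of the real-segment law for every Bateman–Horn system and
  every real `y > 1`: `x⁻¹ (log x)^{k(1−y)} T_x(y) → λ_f(y)/Γ(k(y−1)+1)` (composition of `stub_typeILimit`,
  `stub_typeISandwich`, `stub_typeILocal`, `stub_congruenceFacts`, `stub_levinFainleib`);
* the exact expansion `y^{s(m)} = Σ_{d ∣ m} h_y(d)` (`pow_capped_eq_sum_divSet`, `pow_stat_eq_sum_tuples`) and the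
  exact split `M_x = T_x + K_x` (`typeISum_add_kernelSum`, `normSum_eq_typeI_add_kernel`);
* `betaKernelLaw_iff_segmentLaw` — for each `(k, f, y)` with `y > 1`, the open kernel law `BetaKernelLaw k f y` is
  EQUIVALENT to the crux's segment law at `y` with `Λ := λ_f = eulerFactor f`; `segmentLaw_of_betaKernelLaw`.

The file `…Reduction.lean` adds `eulerFactorClause_holds`, the registered `systemLSDRealSegment_of_betaKernelLaw`
(the crux from the kernel law alone) and `eulerFactor_unique`.
-/

open Filter Finset Polynomial
open scoped BigOperators Topology

namespace Summit.Parity.BatemanHorn.Cruxes.SystemLSDRealSegment.BetaThinnedRootKernel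

open Literature.NumberTheory.Sieve

noncomputable section

/-! ### The landed halves, by name -/

/-- `TypeILaw k f y` — the level-`x` half of the real-segment law — for EVERY Bateman–Horn system and EVERY real
`y > 1` (composition of the landed `stub_typeILimit`, `stub_typeISandwich`, `stub_typeILocal`, `stub_congruenceFacts`,
`stub_levinFainleib`). [folklore] -/
theorem typeILaw_holds :
    ∀ (k : ℕ) (f : Fin k → ℤ[X]), IsBatemanHornSystem f → ∀ y : ℝ, 1 < y → TypeILaw k f y :=
  stub_typeILimit stub_typeISandwich (stub_typeILocal stub_congruenceFacts.2) stub_congruenceFacts.1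
    stub_levinFainleib

/-! ### The thinned-divisor expansion `y^{s(m)} = Σ_{d ∣ m} h_y(d)` and the exact split -/

section Identity

variable {R : Type*} [CommRing R]

/-- `s(p^j) = min j 2`. [folklore] -/
theorem capped_prime_pow' {p : ℕ} (hp : p.Prime) (j : ℕ) : capped (p ^ j) = min j 2 := by
  rw [capped, hp.factorization_pow, Finsupp.sum_single_index (by simp)]

/-- `s` is additive on coprime arguments. [folklore] -/
theorem capped_mul' {m n : ℕ} (hm : m ≠ 0) (hn : n ≠ 0) (h : m.Coprime n) :
    capped (m * n) = capped m + capped n := by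
  unfold capped
  rw [Nat.factorization_mul hm hn, Finsupp.sum_add_index_of_disjoint]
  simpa only [Nat.support_factorization] using h.disjoint_primeFactors

/-- `Σ_{v ≤ j} thinCoeff y v = y²` for `j ≥ 2` (the cap). [folklore] -/
theorem sum_thinCoeff_range_of_two_le' (y : R) {j : ℕ} (hj : 2 ≤ j) :
    ∑ i ∈ range (j + 1), thinCoeff y i = y ^ 2 := by
  induction j, hj using Nat.le_induction with
  | base => simp [Finset.sum_range_succ]
  | succ j hj ih =>
    rw [Finset.sum_range_succ, ih, thinCoeff_of_three_le y (by omega), add_zero]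

/-- `Σ_{v ≤ j} thinCoeff y v = y^{min(j,2)}` — the local form of the expansion. [folklore] -/
theorem sum_thinCoeff_range' (y : R) (j : ℕ) :
    ∑ i ∈ range (j + 1), thinCoeff y i = y ^ min j 2 := by
  rcases Nat.lt_or_ge j 2 with hj | hj
  · interval_cases j <;> simp [Finset.sum_range_succ]
  · rw [min_eq_right hj, sum_thinCoeff_range_of_two_le' y hj]

/-- **THE EXPANSION** `y^{s(m)} = Σ_{d ∣ m} h_y(d)` for `m ≥ 1` (Möbius inversion on prime powers: as arithmetic
functions, `h_y * ζ = y^{s}`, both sides multiplicative). [folklore] -/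
theorem pow_capped_eq_sum_divisors (y : R) {m : ℕ} (hm : m ≠ 0) :
    y ^ capped m = ∑ d ∈ m.divisors, thinWeight y d := by
  classical
  -- the two arithmetic functions, built inline
  let hA : ArithmeticFunction R := ⟨fun d => if d = 0 then 0 else thinWeight y d, if_pos rfl⟩
  let cA : ArithmeticFunction R := ⟨fun n => if n = 0 then 0 else y ^ capped n, if_pos rfl⟩
  have hA_apply : ∀ {d : ℕ}, d ≠ 0 → hA d = thinWeight y d := fun {d} hd => if_neg hd
  have cA_apply : ∀ {n : ℕ}, n ≠ 0 → cA n = y ^ capped n := fun {n} hn => if_neg hn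
  have hA_mult : hA.IsMultiplicative := by
    refine ⟨by rw [hA_apply one_ne_zero, thinWeight_one], ?_⟩
    intro a b hab
    rcases eq_or_ne a 0 with rfl | ha
    · simp [hA]
    rcases eq_or_ne b 0 with rfl | hb
    · simp [hA]
    rw [hA_apply (mul_ne_zero ha hb), hA_apply ha, hA_apply hb]
    exact thinWeight_mul y ha hb hab
  have cA_mult : cA.IsMultiplicative := by
    refine ⟨by rw [cA_apply one_ne_zero]; simp [capped], ?_⟩
    intro a b hab
    rcases eq_or_ne a 0 with rfl | ha
    · simp [cA]
    rcases eq_or_ne b 0 with rfl | hb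
    · simp [cA]
    rw [cA_apply (mul_ne_zero ha hb), cA_apply ha, cA_apply hb, capped_mul' ha hb hab, pow_add]
  have key : hA * (ArithmeticFunction.zeta : ArithmeticFunction R) = cA := by
    rw [ArithmeticFunction.IsMultiplicative.eq_iff_eq_on_prime_powers _
      (hA_mult.mul ArithmeticFunction.isMultiplicative_zeta.natCast) _ cA_mult]
    intro p i hp
    rw [ArithmeticFunction.coe_mul_zeta_apply, Nat.sum_divisors_prime_pow hp,
      cA_apply (pow_ne_zero _ hp.ne_zero), capped_prime_pow' hp]
    rw [Finset.sum_congr rfl fun j _ => by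
      rw [hA_apply (pow_ne_zero _ hp.ne_zero), thinWeight_prime_pow y hp]]
    exact sum_thinCoeff_range' y i
  have h := congrArg (fun F : ArithmeticFunction R => F m) key
  rw [ArithmeticFunction.coe_mul_zeta_apply, cA_apply hm] at h
  rw [← h]
  exact Finset.sum_congr rfl fun d hd => hA_apply (Nat.pos_of_mem_divisors hd).ne'

/-- The expansion with the `0 ↦ {1}` convention, for EVERY `m : ℕ`, with the crux's inner sum verbatim. [folklore] -/
theorem pow_capped_eq_sum_divSet (y : R) (m : ℕ) :
    y ^ (m.factorization.sum fun _ v => min v 2) = ∑ d ∈ divSet m, thinWeight y d := by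
  rcases eq_or_ne m 0 with rfl | hm
  · simp [divSet, thinWeight]
  · rw [divSet, max_eq_left (Nat.one_le_iff_ne_zero.2 hm)]
    exact pow_capped_eq_sum_divisors y hm

/-- The system expansion over divisor TUPLES: `y^{s_f(n)} = Σ_{d ∈ tuples f n} ∏ᵢ h_y(dᵢ)`. [folklore] -/
theorem pow_stat_eq_sum_tuples {k : ℕ} (f : Fin k → ℤ[X]) (y : R) (n : ℕ) :
    y ^ (∑ i, (((f i).eval (n : ℤ)).toNat.factorization.sum fun _ v => min v 2)) =
      ∑ d ∈ tuples f n, ∏ i, thinWeight y (d i) := by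
  rw [← Finset.prod_pow_eq_pow_sum,
    Finset.prod_congr rfl fun i _ => pow_capped_eq_sum_divSet y ((f i).eval (n : ℤ)).toNat,
    tuples, Finset.prod_univ_sum]

end Identity

/-- **The split is exact**: `T_x(y) + K_x(y) = Σ_{0≤n≤x} y^{s_f(n)}` for every family, `y`, `x`. [folklore] -/
theorem typeISum_add_kernelSum {k : ℕ} (f : Fin k → ℤ[X]) (y : ℝ) (x : ℕ) :
    typeISum f y x + kernelSum f y x =
      ∑ n ∈ range (x + 1), y ^ (∑ i, (((f i).eval (n : ℤ)).toNat.factorization.sum fun _ v => min v 2)) := by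
  rw [typeISum, kernelSum, ← Finset.sum_add_distrib]
  refine Finset.sum_congr rfl fun n _ => ?_
  rw [pow_stat_eq_sum_tuples f y n]
  have hK : (tuples f n).filter (fun d => x < ∏ i, d i) =
      (tuples f n).filter (fun d => ¬ (∏ i, d i ≤ x)) :=
    Finset.filter_congr fun d _ => not_le.symm
  rw [hK, Finset.sum_filter_add_sum_filter_not]

/-- The normalised sum of the crux splits into its Type-I and kernel parts (cast to `ℂ`). [folklore] -/
theorem normSum_eq_typeI_add_kernel {k : ℕ} (f : Fin k → ℤ[X]) (y : ℝ) (x : ℕ) :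
    (x : ℂ)⁻¹ * Complex.exp ((k : ℂ) * (1 - (y : ℂ)) * (Real.log (Real.log x) : ℂ)) *
        ∑ n ∈ range (x + 1), (y : ℂ) ^ (∑ i, (((f i).eval (n : ℤ)).toNat.factorization.sum fun _ v => min v 2))
      = (x : ℂ)⁻¹ * Complex.exp ((k : ℂ) * (1 - (y : ℂ)) * (Real.log (Real.log x) : ℂ)) * (typeISum f y x : ℂ)
        + (x : ℂ)⁻¹ * Complex.exp ((k : ℂ) * (1 - (y : ℂ)) * (Real.log (Real.log x) : ℂ)) *
          (kernelSum f y x : ℂ) := by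
  rw [← mul_add, ← Complex.ofReal_add, typeISum_add_kernelSum]
  push_cast
  rfl

/-! ### The kernel law IS the crux with `Λ = λ_f` -/

/-- **Equivalence, one family at one point**: for a Bateman–Horn system `f` and `1 < y`, the kernel law
`BetaKernelLaw k f y` holds iff the crux's segment law holds at `y` with `Λ := eulerFactor f` (the Type-I half being a
theorem, `typeILaw_holds`, and the split being exact). [folklore] -/
theorem betaKernelLaw_iff_segmentLaw {k : ℕ} {f : Fin k → ℤ[X]} (hf : IsBatemanHornSystem f) {y : ℝ}
    (hy : 1 < y) :
    BetaKernelLaw k f y ↔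
      Tendsto (fun x : ℕ => (x : ℂ)⁻¹ * Complex.exp ((k : ℂ) * (1 - (y : ℂ)) * (Real.log (Real.log x) : ℂ)) *
          ∑ n ∈ range (x + 1), (y : ℂ) ^ (∑ i, (((f i).eval (n : ℤ)).toNat.factorization.sum fun _ v => min v 2)))
        atTop
        (𝓝 (eulerFactor f y * Complex.exp (((y : ℂ) - 1) * (Real.log (∏ i, ((f i).natDegree : ℝ)) : ℂ)) *
          (Complex.Gamma y)⁻¹ ^ k)) := by
  have hT := typeILaw_holds k f hf y hy
  unfold TypeILaw at hT
  constructor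
  · intro hK
    unfold BetaKernelLaw at hK
    have h3 := (hT.add hK).congr fun x => (normSum_eq_typeI_add_kernel f y x).symm
    convert h3 using 2
    ring
  · intro hM
    have hM' := hM.congr fun x => normSum_eq_typeI_add_kernel f y x
    have h3 := hM'.sub hT
    unfold BetaKernelLaw
    refine (h3.congr fun x => ?_).trans (le_of_eq ?_)
    · ring
    · congr 1
      ring

/-- **Segment law from the kernel law**: for every Bateman–Horn system, the kernel law on `(5/4, 7/4)` gives the crux's
real-segment law with the EXPLICIT `Λ = eulerFactor f`. [folklore] -/
theorem segmentLaw_of_betaKernelLaw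
    (hK : ∀ (k : ℕ) (f : Fin k → ℤ[X]), IsBatemanHornSystem f → ∀ y : ℝ, 5 / 4 < y → y < 7 / 4 →
      BetaKernelLaw k f y)
    {k : ℕ} {f : Fin k → ℤ[X]} (hf : IsBatemanHornSystem f) (y : ℝ) (hy : 5 / 4 < y) (hy' : y < 7 / 4) :
    Tendsto (fun x : ℕ => (x : ℂ)⁻¹ * Complex.exp ((k : ℂ) * (1 - (y : ℂ)) * (Real.log (Real.log x) : ℂ)) *
        ∑ n ∈ range (x + 1), (y : ℂ) ^ (∑ i, (((f i).eval (n : ℤ)).toNat.factorization.sum fun _ v => min v 2)))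
      atTop
      (𝓝 (eulerFactor f y * Complex.exp (((y : ℂ) - 1) * (Real.log (∏ i, ((f i).natDegree : ℝ)) : ℂ)) *
        (Complex.Gamma y)⁻¹ ^ k)) :=
  (betaKernelLaw_iff_segmentLaw hf (by linarith)).1 (hK k f hf y hy hy')

end

end Summit.Parity.BatemanHorn.Cruxes.SystemLSDRealSegment.BetaThinnedRootKernel
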